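import Summits.CriticalPhenomena.PercolationContinuityZ3.Theorems.PercNearOneGluingNoHeavyLowerTailAntitheticDegTwoVertex
import Summits.CriticalPhenomena.PercolationContinuityZ3.Theorems.PercNearOneGluingNoHeavyLowerTailAntitheticOneSidedCubes
import Summits.CriticalPhenomena.PercolationContinuityZ3.Theorems.PercNearOneGluingNoHeavyLowerTailAntitheticTermOne
import HarnessLib

/-!
# `NoHeavyLowerTail` (stmt-CriticalPhenomena-4575) — antithetic cluster pairs: DEG-2 ELIMINATION IN VERTEX FORM, the CHANGE reduction
# (prim-hp-2 gen 59; entry point of THEOREM FAT, HOME/THEOREM-FAT.md)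

Support file (`--supports stmt-CriticalPhenomena-4575`, hull-port prover `prim-hp-2`, gen 59).  No definitions, no named facts, no sorries;
standard axioms.  VERTEX version.  Setting as …AntitheticDegTwoVertex (`x ≠ s` meets exactly the pairs `e = xy`, `f = xz` of `E`, `y ≠ z`,
`g = yz ∉ E`; `E' = E ∖ {e, f}`; `X'(ω) = openCluster (ω ∩ E') s`, `Y'(ω) = openCluster (ωᶜ ∩ E') s`).

**`Antithetic.DegTwo.deg2_vertex_of_change`.**  With
  `CHANGE = Σ_{ω : ¬(y ∈ X' ω ∧ z ∈ Y' ω)} (F(X' ω ∪ {x}·[y ∈ X' ω]) − F(Y' ω ∪ {x}·[z ∈ Y' ω]))(G(…) − G(…))`  (sum over all `ω ⊆ Sym2 V`;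
= TERM I + TERM II of `DegTwo.deg2_vertex_reduction`):  **`0 ≤ CHANGE → 0 ≤ Σ_{D({x})} (F(X_E ω) − F(Y_E ω))(G(X_E ω) − G(Y_E ω))`**.
`DegTwo.deg2_vertex_reduction` asks for `TI ≥ 0` AND `TII ≥ 0` separately; but TERM II is NEGATIVE on FAT(k) = two k-fans glued at `s`
for k ≥ 6 in both orientations (THEOREM FAN, HOME/THEOREM-Fans.md) while CHANGE = TI + TII ≥ 0 there (THEOREM FAT, HOME/THEOREM-FAT.md:
inner Harris over one side + a one-gadget inequality).  This file is the graph-side entry point for such results: only the SUM is needed,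
because `Σ_D = [tied part ≥ 0] + ½·CHANGE` (same bookkeeping as `deg2_vertex_reduction`: tied/untied split, mirror symmetry, the untied
cluster formulas, coordinate halving in `e`, `f`).
Appendix (gen 59): `Antithetic.TwoStage.pinned_cube_sum_nonneg` — Harris on the red-pinned cube `{ω : e ∈ ω}` of one side (for super-odd
twisted-monotone `K₁, K₂`, `0 ≤ Σ_{ω ∋ e} K₁K₂(X₁ ω, Y₁ ω)`; `superodd_cube_sum_nonneg` + coordinate halving) — hypothesis `hplus` of
`Antithetic.TwoStage.side_sum_nonneg` for a graph side (THEOREM 2H, HOME/THEOREM-FAT.md).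
[cite: VandenbergHaggstromKahn2005, §1 p. 6 ("Harris' inequality"), §1 p. 3 (open cluster `C_s`)]
-/

noncomputable section

namespace Summit.CriticalPhenomena.PercolationContinuityZ3.Theorems

open Literature.Probability.Percolation
open scoped Classical symmDiff

namespace Antithetic

namespace DegTwo

variable {V : Type*}

section Change

variable [Fintype V] {E : Set (Sym2 V)} {s x y z : V} (hxs : x ≠ s) (hxy : x ≠ y) (hxz : x ≠ z) (hyz : y ≠ z)
  (he : s(x, y) ∈ E) (hf : s(x, z) ∈ E) (hdeg : ∀ h ∈ E, x ∈ h → h = s(x, y) ∨ h = s(x, z)) (hg : s(y, z) ∉ E)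
include hxs hxy hxz hyz he hf hdeg hg

/-- **Deg-2 elimination in vertex form, CHANGE version.**  With `E' = E ∖ {xy, xz}`, `X' ω = openCluster (ω ∩ E') s`,
`Y' ω = openCluster (ωᶜ ∩ E') s`: if
`CHANGE = Σ_{ω : ¬(y ∈ X' ω ∧ z ∈ Y' ω)} (F(X' ω ∪ {x}·[y ∈ X' ω]) − F(Y' ω ∪ {x}·[z ∈ Y' ω]))(G(…) − G(…)) ≥ 0`
then the vertex antithetic sum over `D({x})` is nonnegative.  Proof: `Σ_D = [tied part] + 2·[untied part with xy red]`; the untied part is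
`¼·CHANGE` by the untied cluster formulas and coordinate halving; the tied part is `tied_sum_nonneg`. [this work] -/
theorem deg2_vertex_of_change {F G : Set V → ℝ} (hF : Monotone F) (hG : Monotone G)
    (hCH : 0 ≤ ∑ ω ∈ Finset.univ.filter (fun ω : Set (Sym2 V) =>
        ¬ ((openGraph (ω ∩ (E \ {s(x, y), s(x, z)}))).Reachable s y ∧ (openGraph (ωᶜ ∩ (E \ {s(x, y), s(x, z)}))).Reachable s z)),
      (F (openCluster (ω ∩ (E \ {s(x, y), s(x, z)})) s ∪
            {v | v ∈ ({x} : Set V) ∧ y ∈ openCluster (ω ∩ (E \ {s(x, y), s(x, z)})) s}) -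
          F (openCluster (ωᶜ ∩ (E \ {s(x, y), s(x, z)})) s ∪
            {v | v ∈ ({x} : Set V) ∧ z ∈ openCluster (ωᶜ ∩ (E \ {s(x, y), s(x, z)})) s})) *
        (G (openCluster (ω ∩ (E \ {s(x, y), s(x, z)})) s ∪
            {v | v ∈ ({x} : Set V) ∧ y ∈ openCluster (ω ∩ (E \ {s(x, y), s(x, z)})) s}) -
          G (openCluster (ωᶜ ∩ (E \ {s(x, y), s(x, z)})) s ∪
            {v | v ∈ ({x} : Set V) ∧ z ∈ openCluster (ωᶜ ∩ (E \ {s(x, y), s(x, z)})) s}))) :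
    0 ≤ ∑ ω ∈ Finset.univ.filter (fun ω : Set (Sym2 V) =>
        ¬ ((openGraph (ω ∩ E)).Reachable s x ∧ (openGraph (ωᶜ ∩ E)).Reachable s x)),
      (F (openCluster (ω ∩ E) s) - F (openCluster (ωᶜ ∩ E) s)) * (G (openCluster (ω ∩ E) s) - G (openCluster (ωᶜ ∩ E) s)) := by
  have hef := Contract.e_ne_f (x := x) hyz
  set E' := E \ {s(x, y), s(x, z)} with hE'
  have heE' : s(x, y) ∉ E' := fun h => h.2 (Or.inl rfl)
  have hfE' : s(x, z) ∉ E' := fun h => h.2 (Or.inr rfl)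
  let X' : Set (Sym2 V) → Set V := fun ω => openCluster (ω ∩ E') s
  let Y' : Set (Sym2 V) → Set V := fun ω => openCluster (ωᶜ ∩ E') s
  let Ψ : Set (Sym2 V) → ℝ := fun ω =>
    (F (openCluster (ω ∩ E) s) - F (openCluster (ωᶜ ∩ E) s)) * (G (openCluster (ω ∩ E) s) - G (openCluster (ωᶜ ∩ E) s))
  let ΨU : Set (Sym2 V) → ℝ := fun ω =>
    (F (X' ω ∪ {v | v ∈ ({x} : Set V) ∧ y ∈ X' ω}) - F (Y' ω ∪ {v | v ∈ ({x} : Set V) ∧ z ∈ Y' ω})) *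
      (G (X' ω ∪ {v | v ∈ ({x} : Set V) ∧ y ∈ X' ω}) - G (Y' ω ∪ {v | v ∈ ({x} : Set V) ∧ z ∈ Y' ω}))
  let Dp : Set (Sym2 V) → Prop := fun ω => ¬ ((openGraph (ω ∩ E)).Reachable s x ∧ (openGraph (ωᶜ ∩ E)).Reachable s x)
  change 0 ≤ ∑ ω ∈ Finset.univ.filter (fun ω => ¬ ((openGraph (ω ∩ E')).Reachable s y ∧ (openGraph (ωᶜ ∩ E')).Reachable s z)),
    ΨU ω at hCH
  show 0 ≤ ∑ ω ∈ Finset.univ.filter Dp, Ψ ω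
  -- invariance of the `E'`-quantities under toggling `e` or `f`
  have hX'e : ∀ ω, X' (ω ∆ {s(x, y)}) = X' ω := fun ω => by
    show openCluster ((ω ∆ {s(x, y)}) ∩ E') s = openCluster (ω ∩ E') s; rw [symmDiff_singleton_inter heE']
  have hY'e : ∀ ω, Y' (ω ∆ {s(x, y)}) = Y' ω := fun ω => by
    show openCluster ((ω ∆ {s(x, y)})ᶜ ∩ E') s = openCluster (ωᶜ ∩ E') s; rw [compl_symmDiff_singleton_inter heE']
  have hX'f : ∀ ω, X' (ω ∆ {s(x, z)}) = X' ω := fun ω => by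
    show openCluster ((ω ∆ {s(x, z)}) ∩ E') s = openCluster (ω ∩ E') s; rw [symmDiff_singleton_inter hfE']
  have hY'f : ∀ ω, Y' (ω ∆ {s(x, z)}) = Y' ω := fun ω => by
    show openCluster ((ω ∆ {s(x, z)})ᶜ ∩ E') s = openCluster (ωᶜ ∩ E') s; rw [compl_symmDiff_singleton_inter hfE']
  have hmem_e_f : ∀ ω : Set (Sym2 V), s(x, y) ∈ ω ∆ {s(x, z)} ↔ s(x, y) ∈ ω := fun ω => by
    rw [Set.mem_symmDiff, Set.mem_singleton_iff]
    constructor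
    · rintro (⟨h, _⟩ | ⟨h, _⟩); exacts [h, absurd h hef]
    · exact fun h => Or.inl ⟨h, hef⟩
  -- (1) split `D` into tied / `e` red, `f` blue / `e` blue, `f` red
  have hsplit : ∑ ω ∈ Finset.univ.filter Dp, Ψ ω =
      ∑ ω ∈ (Finset.univ.filter Dp).filter (fun ω => (s(x, y) ∈ ω ↔ s(x, z) ∈ ω)), Ψ ω +
      (∑ ω ∈ ((Finset.univ.filter Dp).filter (fun ω => ¬ (s(x, y) ∈ ω ↔ s(x, z) ∈ ω))).filter (fun ω => s(x, y) ∈ ω), Ψ ω +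
       ∑ ω ∈ ((Finset.univ.filter Dp).filter (fun ω => ¬ (s(x, y) ∈ ω ↔ s(x, z) ∈ ω))).filter (fun ω => s(x, y) ∉ ω), Ψ ω) := by
    rw [Finset.sum_filter_add_sum_filter_not, Finset.sum_filter_add_sum_filter_not]
  -- (2) the tied part: every tied colouring lies in `D`
  have htied : ∑ ω ∈ (Finset.univ.filter Dp).filter (fun ω => (s(x, y) ∈ ω ↔ s(x, z) ∈ ω)), Ψ ω =
      ∑ ω ∈ Finset.univ.filter (fun ω : Set (Sym2 V) => (s(x, y) ∈ ω ↔ s(x, z) ∈ ω)), Ψ ω := by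
    refine Finset.sum_congr ?_ fun _ _ => rfl
    ext ω
    simp only [Finset.mem_filter, Finset.mem_univ, true_and]
    exact ⟨fun h => h.2, fun h => ⟨not_both_of_tied hxs hdeg ω h, h⟩⟩
  have htied0 := tied_sum_nonneg hxs hxy hxz hyz he hf hdeg hg hF hG
  -- (3) the `e`-blue / `f`-red part equals the `e`-red / `f`-blue part (complement the colouring)
  have hΨc : ∀ ω, Ψ ωᶜ = Ψ ω := fun ω => by
    show (F (openCluster (ωᶜ ∩ E) s) - F (openCluster (ωᶜᶜ ∩ E) s)) * (G (openCluster (ωᶜ ∩ E) s) - G (openCluster (ωᶜᶜ ∩ E) s)) =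
      (F (openCluster (ω ∩ E) s) - F (openCluster (ωᶜ ∩ E) s)) * (G (openCluster (ω ∩ E) s) - G (openCluster (ωᶜ ∩ E) s))
    rw [compl_compl]; ring
  have hDc : ∀ ω, Dp ωᶜ ↔ Dp ω := fun ω => by
    show ¬ ((openGraph (ωᶜ ∩ E)).Reachable s x ∧ (openGraph (ωᶜᶜ ∩ E)).Reachable s x) ↔
      ¬ ((openGraph (ω ∩ E)).Reachable s x ∧ (openGraph (ωᶜ ∩ E)).Reachable s x)
    rw [compl_compl, and_comm]
  have hmirror :
      ∑ ω ∈ ((Finset.univ.filter Dp).filter (fun ω => ¬ (s(x, y) ∈ ω ↔ s(x, z) ∈ ω))).filter (fun ω => s(x, y) ∉ ω), Ψ ω =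
      ∑ ω ∈ ((Finset.univ.filter Dp).filter (fun ω => ¬ (s(x, y) ∈ ω ↔ s(x, z) ∈ ω))).filter (fun ω => s(x, y) ∈ ω), Ψ ω := by
    refine Finset.sum_nbij' compl compl ?_ ?_ ?_ ?_ ?_
    · intro ω hω
      simp only [Finset.mem_filter, Finset.mem_univ, true_and] at hω ⊢
      obtain ⟨⟨hD, hnt⟩, hne⟩ := hω
      refine ⟨⟨(hDc ω).2 hD, ?_⟩, ?_⟩
      · rw [Set.mem_compl_iff, Set.mem_compl_iff]; tauto
      · exact hne
    · intro ω hω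
      simp only [Finset.mem_filter, Finset.mem_univ, true_and] at hω ⊢
      obtain ⟨⟨hD, hnt⟩, hme⟩ := hω
      refine ⟨⟨(hDc ω).2 hD, ?_⟩, ?_⟩
      · rw [Set.mem_compl_iff, Set.mem_compl_iff]; tauto
      · rw [Set.mem_compl_iff, not_not]; exact hme
    · intro ω _; exact compl_compl ω
    · intro ω _; exact compl_compl ω
    · intro ω _; exact (hΨc ω).symm
  -- (4) the untied part with `e` red, `f` blue, rewritten on `E'`
  have huntied :
      ∑ ω ∈ ((Finset.univ.filter Dp).filter (fun ω => ¬ (s(x, y) ∈ ω ↔ s(x, z) ∈ ω))).filter (fun ω => s(x, y) ∈ ω), Ψ ω =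
      ∑ ω ∈ Finset.univ.filter (fun ω : Set (Sym2 V) =>
        (s(x, y) ∈ ω ∧ s(x, z) ∉ ω) ∧ ¬ (y ∈ X' ω ∧ z ∈ Y' ω)), ΨU ω := by
    refine Finset.sum_congr ?_ ?_
    · ext ω
      simp only [Finset.mem_filter, Finset.mem_univ, true_and]
      constructor
      · rintro ⟨⟨hD, hnt⟩, h1⟩
        have h2 : s(x, z) ∉ ω := fun h2 => hnt ⟨fun _ => h2, fun _ => h1⟩
        refine ⟨⟨h1, h2⟩, fun ⟨hy, hz⟩ => hD ⟨?_, ?_⟩⟩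
        · show x ∈ openCluster (ω ∩ E) s
          rw [red_untied hxs hxy he hdeg ω h1 h2]; exact Or.inr ⟨rfl, hy⟩
        · show x ∈ openCluster (ωᶜ ∩ E) s
          rw [blue_untied hxs hxz hf hdeg ω h1 h2]; exact Or.inr ⟨rfl, hz⟩
      · rintro ⟨⟨h1, h2⟩, hn⟩
        refine ⟨⟨fun ⟨hr, hb⟩ => hn ⟨?_, ?_⟩, fun h => h2 (h.1 h1)⟩, h1⟩
        · have hr' : x ∈ openCluster (ω ∩ E) s := hr
          rw [red_untied hxs hxy he hdeg ω h1 h2] at hr'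
          rcases hr' with h | ⟨-, h⟩
          · exact absurd (show (openGraph (ω ∩ E')).Reachable s x from h)
              (Pendant.not_reachable_leaf (ω ∩ E') x (fun h hh hx => x_isolated hdeg h hh.2 hx) hxs.symm)
          · exact h
        · have hb' : x ∈ openCluster (ωᶜ ∩ E) s := hb
          rw [blue_untied hxs hxz hf hdeg ω h1 h2] at hb'
          rcases hb' with h | ⟨-, h⟩
          · exact absurd (show (openGraph (ωᶜ ∩ E')).Reachable s x from h)
              (Pendant.not_reachable_leaf (ωᶜ ∩ E') x (fun h hh hx => x_isolated hdeg h hh.2 hx) hxs.symm)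
          · exact h
    · intro ω hω
      simp only [Finset.mem_filter, Finset.mem_univ, true_and] at hω
      obtain ⟨⟨h1, h2⟩, -⟩ := hω
      show (F (openCluster (ω ∩ E) s) - F (openCluster (ωᶜ ∩ E) s)) * (G (openCluster (ω ∩ E) s) - G (openCluster (ωᶜ ∩ E) s)) = ΨU ω
      rw [red_untied hxs hxy he hdeg ω h1 h2, blue_untied hxs hxz hf hdeg ω h1 h2]
  -- (5) coordinate halving in `e`, `f` of the CHANGE sum (the `E'`-quantities do not see `e`, `f`)
  let S₀ : Finset (Set (Sym2 V)) := Finset.univ.filter (fun ω : Set (Sym2 V) => ¬ (y ∈ X' ω ∧ z ∈ Y' ω))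
  have hΨUe : ∀ ω, ΨU (ω ∆ {s(x, y)}) = ΨU ω := fun ω => by simp only [ΨU, hX'e, hY'e]
  have hΨUf : ∀ ω, ΨU (ω ∆ {s(x, z)}) = ΨU ω := fun ω => by simp only [ΨU, hX'f, hY'f]
  have hPe : ∀ ω, ω ∆ {s(x, y)} ∈ S₀ ↔ ω ∈ S₀ := fun ω => by
    simp only [S₀, Finset.mem_filter, Finset.mem_univ, true_and, hX'e, hY'e]
  have hPf : ∀ ω, ω ∆ {s(x, z)} ∈ S₀.filter (fun ω => s(x, y) ∈ ω) ↔ ω ∈ S₀.filter (fun ω => s(x, y) ∈ ω) := fun ω => by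
    simp only [S₀, Finset.mem_filter, Finset.mem_univ, true_and, hX'f, hY'f, hmem_e_f]
  have hU1 := sum_toggle s(x, y) S₀ ΨU hPe hΨUe
  have hU2 := sum_toggle_not s(x, z) (S₀.filter (fun ω => s(x, y) ∈ ω)) ΨU hPf hΨUf
  have hU3 : ∑ ω ∈ (S₀.filter (fun ω => s(x, y) ∈ ω)).filter (fun ω => s(x, z) ∉ ω), ΨU ω =
      ∑ ω ∈ Finset.univ.filter (fun ω : Set (Sym2 V) =>
        (s(x, y) ∈ ω ∧ s(x, z) ∉ ω) ∧ ¬ (y ∈ X' ω ∧ z ∈ Y' ω)), ΨU ω := by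
    refine Finset.sum_congr ?_ fun _ _ => rfl
    ext ω
    simp only [S₀, Finset.mem_filter, Finset.mem_univ, true_and]
    tauto
  have hCH' : (0 : ℝ) ≤ 2 * (2 * ∑ ω ∈ Finset.univ.filter (fun ω : Set (Sym2 V) =>
        (s(x, y) ∈ ω ∧ s(x, z) ∉ ω) ∧ ¬ (y ∈ X' ω ∧ z ∈ Y' ω)), ΨU ω) := by
    have h := hCH
    change 0 ≤ ∑ ω ∈ S₀, ΨU ω at h
    rw [hU1, hU2, hU3] at h
    exact h
  -- (6) assemble
  rw [hsplit, htied, hmirror, huntied]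
  linarith [htied0, hCH']

end Change

end DegTwo

namespace TwoStage

variable {V : Type*} [Fintype V]

/-- **Harris on the red-pinned cube** `{ω : e ∈ ω}` for one side `E₁ ∋ e`: for super-odd twisted-monotone `K₁, K₂`,
`0 ≤ Σ_{ω ∋ e} K₁(X₁ ω, Y₁ ω) K₂(X₁ ω, Y₁ ω)` (`superodd_cube_sum_nonneg` on `T ↦ (X₁(T ∪ {e}), Y₁(T ∪ {e}))` + coordinate halving).
[this work] -/
theorem pinned_cube_sum_nonneg (E₁ : Set (Sym2 V)) (s : V) (e : Sym2 V) {K₁ K₂ : Set V → Set V → ℝ}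
    (hK₁ : ∀ ⦃P P' Q Q' : Set V⦄, P ⊆ P' → Q' ⊆ Q → K₁ P Q ≤ K₁ P' Q') (hso₁ : ∀ P Q, 0 ≤ K₁ P Q + K₁ Q P)
    (hK₂ : ∀ ⦃P P' Q Q' : Set V⦄, P ⊆ P' → Q' ⊆ Q → K₂ P Q ≤ K₂ P' Q') (hso₂ : ∀ P Q, 0 ≤ K₂ P Q + K₂ Q P) :
    0 ≤ ∑ ω ∈ Finset.univ.filter (fun ω : Set (Sym2 V) => e ∈ ω),
      K₁ (openCluster (ω ∩ E₁) s) (openCluster (ωᶜ ∩ E₁) s) * K₂ (openCluster (ω ∩ E₁) s) (openCluster (ωᶜ ∩ E₁) s) := by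
  let Wr : Set (Sym2 V) → Set V := fun T => openCluster ((T ∪ {e}) ∩ E₁) s
  let Wb : Set (Sym2 V) → Set V := fun T => openCluster ((T ∪ {e})ᶜ ∩ E₁) s
  have hWr : Monotone Wr := fun T T' h =>
    Freeze.openCluster_mono (Set.inter_subset_inter_left E₁ (Set.union_subset_union_left _ h)) s
  have hWb : Antitone Wb := fun T T' h =>
    Freeze.openCluster_mono (Set.inter_subset_inter_left E₁ (Set.compl_subset_compl.2 (Set.union_subset_union_left _ h))) s
  have hdom : ∀ T, Wb Tᶜ ⊆ Wr T := by
    intro T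
    refine Freeze.openCluster_mono (Set.inter_subset_inter_left E₁ ?_) s
    intro f hf
    rw [Set.mem_compl_iff, Set.mem_union, not_or, Set.mem_compl_iff, not_not] at hf
    exact Or.inl hf.1
  have hcube := superodd_cube_sum_nonneg Wr Wb hWr hWb hdom hK₁ hso₁ hK₂ hso₂
  have hue : ∀ T : Set (Sym2 V), (T ∆ {e}) ∪ {e} = T ∪ {e} := by
    intro T; ext f
    simp only [Set.mem_union, Set.mem_symmDiff, Set.mem_singleton_iff]
    tauto
  have htog := DegTwo.sum_toggle e (Finset.univ : Finset (Set (Sym2 V))) (fun T => K₁ (Wr T) (Wb T) * K₂ (Wr T) (Wb T))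
    (fun T => by simp) (fun T => by show K₁ (Wr (T ∆ {e})) (Wb (T ∆ {e})) * K₂ (Wr (T ∆ {e})) (Wb (T ∆ {e})) = _; simp only [Wr, Wb, hue])
  have hre : ∑ ω ∈ Finset.univ.filter (fun ω : Set (Sym2 V) => e ∈ ω), K₁ (Wr ω) (Wb ω) * K₂ (Wr ω) (Wb ω) =
      ∑ ω ∈ Finset.univ.filter (fun ω : Set (Sym2 V) => e ∈ ω),
        K₁ (openCluster (ω ∩ E₁) s) (openCluster (ωᶜ ∩ E₁) s) * K₂ (openCluster (ω ∩ E₁) s) (openCluster (ωᶜ ∩ E₁) s) := by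
    refine Finset.sum_congr rfl fun ω hω => ?_
    have he : e ∈ ω := (Finset.mem_filter.1 hω).2
    have hωe : ω ∪ {e} = ω := Set.union_eq_self_of_subset_right (Set.singleton_subset_iff.2 he)
    simp only [Wr, Wb, hωe]
  have h2 : ∑ T : Set (Sym2 V), K₁ (Wr T) (Wb T) * K₂ (Wr T) (Wb T) =
      2 * ∑ ω ∈ Finset.univ.filter (fun ω : Set (Sym2 V) => e ∈ ω), K₁ (Wr ω) (Wb ω) * K₂ (Wr ω) (Wb ω) := htog
  rw [← hre]
  linarith

end TwoStage

end Antithetic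

end Summit.CriticalPhenomena.PercolationContinuityZ3.Theorems
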